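import Literature.AnabelianGeometry.EtaleTheta.SubmonoidPerfection
import Literature.AnabelianGeometry.EtaleTheta.RealificationOrder
import Literature.AnabelianGeometry.EtaleTheta.RSupportedMonoids

/-!
# [EtTh] Lemma 3.5, the "`P^rlf`" portion: realifications of perf-factorial submonoids — proofs

Source: S. Mochizuki, *The étale theta function and its Frobenioid-theoretic manifestations*,
Publ. RIMS **45** (2009) [MochizukiEtTh2009], Lemma 3.5, PDF pp. 75–76 (printed 301–302); locators
`p.N` = PDF page of the PRIMS text.

Lemma 3.5 ("Perfections and Realifications of Perf-factorial Submonoids"): "Let `P`, `Q` be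
perf-factorial monoids such that: (a) `P` is a submonoid of `Q`; (b) `P` is group-saturated in `Q`;
(c) `ℝ` supports `Q`. Then: (i) The inclusion `P ↪ Q` extends uniquely to inclusions `P^pf ↪ Q`,
`P^rlf ↪ Q`. (ii) Relative to the inclusions of (i), `P^pf`, `P^rlf` are group-saturated in `Q`."
The `P^pf` portion is `SubmonoidPerfection.lean` (seat abc-iut-L6-t12). THIS FILE proves the `P^rlf`
portion, stub-free, for the tree's realification `IsPerfFactorial.realification` ([FrdI] Def. 2.4 (i),
`Frobenioids/PerfFactorial.lean`) and the tree's "`ℝ` supports `Q`" (`Supports Q .R`, Def. 2.4 (ii)):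

* `exists_rlf_hom_comp_eq`, `rlf_hom_ext` — (i): every `ι : P^pf → Q` extends UNIQUELY to a
  homomorphism `φ : P^rlf → Q`;
* `dvd_of_rlf_hom_dvd` — (i)/(ii): if `ι` is injective with group-saturated image (the `P^pf` portion),
  every such `φ` reflects `≤` (hence is injective, with group-saturated image), as in print p. 76.
The packaged statements of Lemma 3.5 (i), (ii) for `P^rlf` — with the monoprimality hypothesis `hb`
below discharged — are in `Discharge/Sec3Lemma35Rlf.lean`.

**Route.** The printed construction sums, for each prime `𝔮` of `Q`, the images of the primary
components of `a ∈ P^rlf` in `Q_𝔮 ≅ ℝ_{≥0}` (p. 75). We realise `φ(x)` instead as the unique element of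
`Q` lying between `ι({a ∈ P^pf | a ≤ x})` and `ι({b ∈ P^pf | x ≤ b})` (`ι : P^pf ↪ Q`): existence by
the completeness of `Q` (suprema exist since `ℝ` supports `Q`, `RSupportedMonoids.lean`), uniqueness
because the two sets come within an `n`-th root of a fixed gauge of each other for every `n`
(`RealificationOrder.lean`) and `Q` is archimedean. This between-characterisation gives additivity,
the extension property, uniqueness of `φ`, and — with group-saturation of `P^pf` in `Q` — order
reflection, hence injectivity and (ii), following the printed argument of p. 76.

Hypothesis `hb` ("every `P^pf_𝔮` is monoprime") is [FrdI] Def. 2.4 (i)(b) for `P^pf`; it is proved in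
`PerfectionPrimes.lean` and eliminated in `Discharge/Sec3Lemma35Rlf.lean`. Proof-only (no
definitions). Seat abc-iut-L2-d2 (cell abc-iut, node EtTh:Lem3.5 rlf portion, step 4/5).
-/

namespace Literature.AnabelianGeometry.EtaleTheta

namespace Lemma35

open Literature.AlgebraicGeometry.Frobenioids NNReal Function

universe u

variable {Q : Type u} [CommMonoid Q]

/-! ### Between-elements in a monoid supported by `ℝ` -/

/-- If `ℝ` supports `Q`, `L ≤ U` elementwise, `L ≠ ∅ ≠ U`, then some `s ∈ Q` lies between `L` and `U`
(the supremum of `L`; "this sum converges to an element of `Q_𝔮 ≅ ℝ_{≥0}` … factors through `Q`",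
p. 75). [cite: MochizukiEtTh2009, Lem 3.5 p.75] -/
theorem exists_between (hR : Supports Q MonoidType.R) {L U : Set Q}
    (hLU : ∀ l ∈ L, ∀ w ∈ U, l ∣ w) (hL : L.Nonempty) (hU : U.Nonempty) :
    ∃ s : Q, (∀ l ∈ L, l ∣ s) ∧ ∀ w ∈ U, s ∣ w := by
  obtain ⟨w₀, hw₀⟩ := hU
  obtain ⟨s, hs, hs'⟩ := RSupported.exists_isLUB hR L hL w₀ (fun l hl => hLU l hl w₀ hw₀)
  exact ⟨s, hs, fun w hw => hs' w (fun l hl => hLU l hl w hw)⟩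

/-- If `ℝ` supports `Q` and `L`, `U` come within an `n`-th root of a fixed `c₀` of each other for every
`n ≥ 1`, then at most one element of `Q` lies between `L` and `U` (archimedean property of `Q`).
[cite: MochizukiEtTh2009, Lem 3.5 p.76] -/
theorem between_unique (hR : Supports Q MonoidType.R) {L U : Set Q} {c₀ : Q}
    (hgap : ∀ n : ℕ+, ∃ l ∈ L, ∃ e : Q, e ^ (n : ℕ) = c₀ ∧ l * e ∈ U) {s s' : Q}
    (hs : (∀ l ∈ L, l ∣ s) ∧ ∀ w ∈ U, s ∣ w) (hs' : (∀ l ∈ L, l ∣ s') ∧ ∀ w ∈ U, s' ∣ w) : s = s' := by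
  have key : ∀ {t t' : Q}, ((∀ l ∈ L, l ∣ t) ∧ ∀ w ∈ U, t ∣ w) →
      ((∀ l ∈ L, l ∣ t') ∧ ∀ w ∈ U, t' ∣ w) → t ∣ t' := by
    intro t t' ht ht'
    apply RSupported.dvd_of_forall_root hR (c₀ := c₀)
    intro n
    obtain ⟨l, hl, e, he, hle⟩ := hgap n
    exact ⟨e, he, (ht.2 _ hle).trans (mul_dvd_mul_right (ht'.1 l hl) e)⟩
  exact RSupported.dvd_antisymm hR (key hs hs') (key hs' hs)

/-! ### The extension `φ : P^rlf → Q` through between-elements -/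

section Construction

variable {P : Submonoid Q} (hP : IsPerfFactorial P)

/-- Uniqueness of an element of `Q` squeezed between `ι({a·a' | a ≤ x, a' ≤ y})` and
`ι({b·b' | x ≤ b, y ≤ b'})` (`a, a', b, b' ∈ P^pf`; `x, y ∈ P^rlf`): the two families come within
`n`-th roots of the product of gauges of `x` and `y`. [cite: MochizukiEtTh2009, Lem 3.5 p.76] -/
private theorem between₂_unique (hb : ∀ 𝔮 : Primes (Perfection P), IsMonoprime (PfAt P 𝔮)) (ι : Perfection P →* Q)
    (hR : Supports Q MonoidType.R) (x y : hP.Rlf) {q q' : Q}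
    (hq : (∀ a a' : Perfection P, hP.toRealification a ∣ x → hP.toRealification a' ∣ y → ι (a * a') ∣ q) ∧
      ∀ b b' : Perfection P, x ∣ hP.toRealification b → y ∣ hP.toRealification b' → q ∣ ι (b * b'))
    (hq' : (∀ a a' : Perfection P, hP.toRealification a ∣ x → hP.toRealification a' ∣ y → ι (a * a') ∣ q') ∧
      ∀ b b' : Perfection P, x ∣ hP.toRealification b → y ∣ hP.toRealification b' → q' ∣ ι (b * b')) :
    q = q' := by
  obtain ⟨bx, -, hgx⟩ := RlfCoord.exists_gauge hP hb x
  obtain ⟨by_, -, hgy⟩ := RlfCoord.exists_gauge hP hb y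
  let L : Set Q := {l | ∃ a a' : Perfection P,
    hP.toRealification a ∣ x ∧ hP.toRealification a' ∣ y ∧ ι (a * a') = l}
  let U : Set Q := {w | ∃ b b' : Perfection P,
    x ∣ hP.toRealification b ∧ y ∣ hP.toRealification b' ∧ ι (b * b') = w}
  have hgap : ∀ n : ℕ+, ∃ l ∈ L, ∃ e : Q, e ^ (n : ℕ) = ι (bx * by_) ∧ l * e ∈ U := by
    intro n
    obtain ⟨a, ha, hax⟩ := hgx n
    obtain ⟨a', ha', hay⟩ := hgy n
    refine ⟨ι (a * a'), ⟨a, a', ha, ha', rfl⟩,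
      ι (isPerfect_perfection.root n bx * isPerfect_perfection.root n by_), ?_, ?_⟩
    · rw [← map_pow, mul_pow, IsPerfect.root_pow, IsPerfect.root_pow]
    · refine ⟨a * isPerfect_perfection.root n bx, a' * isPerfect_perfection.root n by_, hax, hay, ?_⟩
      rw [← map_mul]
      congr 1
      simp only [mul_assoc, mul_left_comm]
  have mk : ∀ {t : Q},
      ((∀ a a' : Perfection P, hP.toRealification a ∣ x → hP.toRealification a' ∣ y → ι (a * a') ∣ t) ∧
        ∀ b b' : Perfection P, x ∣ hP.toRealification b → y ∣ hP.toRealification b' → t ∣ ι (b * b')) →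
      (∀ l ∈ L, l ∣ t) ∧ ∀ w ∈ U, t ∣ w := by
    intro t ht
    constructor
    · rintro _ ⟨a, a', ha, ha', rfl⟩
      exact ht.1 a a' ha ha'
    · rintro _ ⟨b, b', hb1, hb2, rfl⟩
      exact ht.2 b b' hb1 hb2
  exact between_unique hR hgap (mk hq) (mk hq')

/-- Uniqueness of an element of `Q` squeezed between `ι({a | a ≤ x})` and `ι({b | x ≤ b})`.
[cite: MochizukiEtTh2009, Lem 3.5 p.76] -/
private theorem between_point_unique (hb : ∀ 𝔮 : Primes (Perfection P), IsMonoprime (PfAt P 𝔮)) (ι : Perfection P →* Q)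
    (hR : Supports Q MonoidType.R) (x : hP.Rlf) {q q' : Q}
    (hq : (∀ a : Perfection P, hP.toRealification a ∣ x → ι a ∣ q) ∧
      ∀ b : Perfection P, x ∣ hP.toRealification b → q ∣ ι b)
    (hq' : (∀ a : Perfection P, hP.toRealification a ∣ x → ι a ∣ q') ∧
      ∀ b : Perfection P, x ∣ hP.toRealification b → q' ∣ ι b) :
    q = q' := by
  have lift : ∀ {t : Q}, ((∀ a : Perfection P, hP.toRealification a ∣ x → ι a ∣ t) ∧
      ∀ b : Perfection P, x ∣ hP.toRealification b → t ∣ ι b) →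
      ((∀ a a' : Perfection P, hP.toRealification a ∣ x → hP.toRealification a' ∣ 1 → ι (a * a') ∣ t) ∧
        ∀ b b' : Perfection P, x ∣ hP.toRealification b → (1 : hP.Rlf) ∣ hP.toRealification b' →
          t ∣ ι (b * b')) := by
    intro t ht
    constructor
    · intro a a' ha ha'
      apply ht.1
      rw [map_mul]
      simpa using mul_dvd_mul ha ha'
    · intro b b' hb1 _
      rw [map_mul]
      exact (ht.2 b hb1).trans (dvd_mul_right _ _)
  exact between₂_unique hP hb ι hR x 1 (lift hq) (lift hq')

/-- Existence of an element of `Q` squeezed between `ι({a | a ≤ x})` and `ι({b | x ≤ b})` (the value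
`φ(x)`; "this sum converges", p. 75). [cite: MochizukiEtTh2009, Lem 3.5 p.75] -/
private theorem between_point_exists (hb : ∀ 𝔮 : Primes (Perfection P), IsMonoprime (PfAt P 𝔮)) (ι : Perfection P →* Q)
    (hR : Supports Q MonoidType.R) (x : hP.Rlf) :
    ∃ q : Q, (∀ a : Perfection P, hP.toRealification a ∣ x → ι a ∣ q) ∧
      ∀ b : Perfection P, x ∣ hP.toRealification b → q ∣ ι b := by
  let L : Set Q := {l | ∃ a : Perfection P, hP.toRealification a ∣ x ∧ ι a = l}
  let U : Set Q := {w | ∃ b : Perfection P, x ∣ hP.toRealification b ∧ ι b = w}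
  have hLU : ∀ l ∈ L, ∀ w ∈ U, l ∣ w := by
    rintro _ ⟨a, ha, rfl⟩ _ ⟨b, hb', rfl⟩
    exact map_dvd ι ((RlfCoord.toRealification_dvd_iff hP hb a b).mp (ha.trans hb'))
  have hL : L.Nonempty := ⟨ι 1, 1, by rw [map_one]; exact one_dvd x, rfl⟩
  obtain ⟨b₀, hb₀, -⟩ := RlfCoord.exists_gauge hP hb x
  have hU : U.Nonempty := ⟨ι b₀, b₀, hb₀, rfl⟩
  obtain ⟨s, hs, hs'⟩ := exists_between hR hLU hL hU
  exact ⟨s, fun a ha => hs _ ⟨a, ha, rfl⟩, fun b hb' => hs' _ ⟨b, hb', rfl⟩⟩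

/-- **Construction of `φ : P^rlf → Q`.** There is a monoid homomorphism `φ` such that each `φ(x)` is
squeezed between `ι({a ∈ P^pf | a ≤ x})` and `ι({b ∈ P^pf | x ≤ b})` (additivity by uniqueness of the
squeezed element for products). [cite: MochizukiEtTh2009, Lem 3.5 p.75] -/
private theorem exists_hom_between (hb : ∀ 𝔮 : Primes (Perfection P), IsMonoprime (PfAt P 𝔮)) (ι : Perfection P →* Q)
    (hR : Supports Q MonoidType.R) :
    ∃ φ : hP.Rlf →* Q, ∀ x : hP.Rlf, (∀ a : Perfection P, hP.toRealification a ∣ x → ι a ∣ φ x) ∧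
      ∀ b : Perfection P, x ∣ hP.toRealification b → φ x ∣ ι b := by
  choose Φ hΦ using between_point_exists hP hb ι hR
  refine ⟨{ toFun := Φ, map_one' := ?_, map_mul' := fun x y => ?_ }, hΦ⟩
  · apply between_point_unique hP hb ι hR 1 (hΦ 1)
    constructor
    · intro a ha
      rw [← map_one hP.toRealification, RlfCoord.toRealification_dvd_iff hP hb] at ha
      rw [← map_one ι]
      exact map_dvd ι ha
    · intro b _
      exact one_dvd _
  · apply between₂_unique hP hb ι hR x y
    · constructor
      · intro a a' ha ha'
        apply (hΦ (x * y)).1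
        rw [map_mul]
        exact mul_dvd_mul ha ha'
      · intro b b' hb1 hb2
        apply (hΦ (x * y)).2
        rw [map_mul]
        exact mul_dvd_mul hb1 hb2
    · constructor
      · intro a a' ha ha'
        rw [map_mul]
        exact mul_dvd_mul ((hΦ x).1 a ha) ((hΦ y).1 a' ha')
      · intro b b' hb1 hb2
        rw [map_mul]
        exact mul_dvd_mul ((hΦ x).2 b hb1) ((hΦ y).2 b' hb2)

/-- A homomorphism `ψ : P^rlf → Q` extending `ι : P^pf → Q` is squeezed: `ι a ≤ ψ x ≤ ι b` whenever
`a ≤ x ≤ b`. [cite: MochizukiEtTh2009, Lem 3.5 p.76] -/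
private theorem between_of_comp_eq (ι : Perfection P →* Q) (ψ : hP.Rlf →* Q)
    (hψ : ψ.comp hP.toRealification = ι) (x : hP.Rlf) :
    (∀ a : Perfection P, hP.toRealification a ∣ x → ι a ∣ ψ x) ∧
      ∀ b : Perfection P, x ∣ hP.toRealification b → ψ x ∣ ι b := by
  constructor
  · intro a ha
    rw [← hψ]
    exact map_dvd ψ ha
  · intro b hb'
    rw [← hψ]
    exact map_dvd ψ hb'

/-- **Existence of the extension** `P^pf → Q` ↝ `P^rlf → Q`: for every `ι : P^pf → Q` there is
`φ : P^rlf → Q` with `φ ∘ (P^pf → P^rlf) = ι`, provided `ℝ` supports `Q` ("extends … to a homomorphism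
of monoids `φ : P^rlf → Q`", pp. 75–76). [cite: MochizukiEtTh2009, Lem 3.5 p.75] -/
theorem exists_rlf_hom_comp_eq (hb : ∀ 𝔮 : Primes (Perfection P), IsMonoprime (PfAt P 𝔮)) (ι : Perfection P →* Q)
    (hR : Supports Q MonoidType.R) :
    ∃ φ : hP.Rlf →* Q, φ.comp hP.toRealification = ι := by
  obtain ⟨φ, hφ⟩ := exists_hom_between hP hb ι hR
  refine ⟨φ, MonoidHom.ext fun a₀ => ?_⟩
  apply between_point_unique hP hb ι hR (hP.toRealification a₀) (hφ _)
  constructor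
  · intro a ha
    exact map_dvd ι ((RlfCoord.toRealification_dvd_iff hP hb a a₀).mp ha)
  · intro b hb'
    exact map_dvd ι ((RlfCoord.toRealification_dvd_iff hP hb a₀ b).mp hb')

/-- **Uniqueness of the extension**: two homomorphisms `P^rlf → Q` that agree on `P^pf` coincide,
provided `ℝ` supports `Q` ("uniquely characterized by the property that it extends the natural
homomorphism of monoids `P^pf → Q`", p. 76). [cite: MochizukiEtTh2009, Lem 3.5 p.76] -/
theorem rlf_hom_ext (hb : ∀ 𝔮 : Primes (Perfection P), IsMonoprime (PfAt P 𝔮)) (ι : Perfection P →* Q)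
    (hR : Supports Q MonoidType.R) (ψ ψ' : hP.Rlf →* Q)
    (hψ : ψ.comp hP.toRealification = ι) (hψ' : ψ'.comp hP.toRealification = ι) : ψ = ψ' :=
  MonoidHom.ext fun x => between_point_unique hP hb ι hR x
    (between_of_comp_eq hP ι ψ hψ x) (between_of_comp_eq hP ι ψ' hψ' x)

/-- **Order reflection** ("we conclude that `a ≥ b`", p. 76): if `ι : P^pf ↪ Q` is injective with
group-saturated image — the `P^pf` portion of Lemma 3.5 (i), (ii) — then any `ψ : P^rlf → Q` extending
`ι` reflects `≤`: `ψ x ≤ ψ y ⇒ x ≤ y`. [cite: MochizukiEtTh2009, Lem 3.5 p.76] -/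
theorem dvd_of_rlf_hom_dvd (hb : ∀ 𝔮 : Primes (Perfection P), IsMonoprime (PfAt P 𝔮)) (ι : Perfection P →* Q)
    (hιinj : Injective ι)
    (hιsat : IsGroupSaturated (MonoidHom.mrange ι)) (ψ : hP.Rlf →* Q)
    (hψ : ψ.comp hP.toRealification = ι) {x y : hP.Rlf} (h : ψ x ∣ ψ y) : x ∣ y := by
  -- `ι` reflects divisibility, by group-saturation of its image and injectivity
  have hιdvd : ∀ a b : Perfection P, ι a ∣ ι b → a ∣ b := by
    rintro a b ⟨q, hq⟩
    rw [isGroupSaturated_iff'] at hιsat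
    have hqmem : q ∈ MonoidHom.mrange ι :=
      hιsat q (ι b) ⟨b, rfl⟩ (ι a) ⟨a, rfl⟩ (by rw [mul_comm]; exact hq.symm)
    obtain ⟨d, rfl⟩ := MonoidHom.mem_mrange.mp hqmem
    exact ⟨d, hιinj (by rw [map_mul, hq])⟩
  obtain ⟨bx, -, hgx⟩ := RlfCoord.exists_gauge hP hb x
  obtain ⟨by_, -, hgy⟩ := RlfCoord.exists_gauge hP hb y
  apply RlfCoord.dvd_of_forall_root hP hb (C := hP.toRealification (bx * by_))
  intro n
  obtain ⟨a, ha, hax⟩ := hgx n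
  obtain ⟨a', ha', hay⟩ := hgy n
  set ex := isPerfect_perfection.root n bx with hex
  set ey := isPerfect_perfection.root n by_ with hey
  refine ⟨hP.toRealification (ex * ey), ?_, ?_⟩
  · rw [← map_pow, mul_pow, hex, hey, IsPerfect.root_pow, IsPerfect.root_pow]
  · -- `a ≤ a' · ey` in `P^pf`, via `ι` and `ψ`
    have h1 : ι a ∣ ι (a' * ey) := by
      rw [← hψ]
      exact (map_dvd ψ ha).trans (h.trans (map_dvd ψ hay))
    have h2 : hP.toRealification a ∣ y * hP.toRealification ey := by
      have := map_dvd hP.toRealification (hιdvd _ _ h1)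
      rw [map_mul] at this
      exact this.trans (mul_dvd_mul_right ha' _)
    calc x ∣ hP.toRealification (a * ex) := hax
      _ = hP.toRealification a * hP.toRealification ex := map_mul _ _ _
      _ ∣ (y * hP.toRealification ey) * hP.toRealification ex := mul_dvd_mul_right h2 _
      _ = y * hP.toRealification (ex * ey) := by rw [map_mul, mul_assoc, mul_comm (hP.toRealification ey)]

end Construction

end Lemma35

end Literature.AnabelianGeometry.EtaleTheta
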